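/- EXTRA WIDTH seat `ym-line-cbag-p1-w5` (prover-ym-line-cbag-p1-w5-g17-0), LINE 7b `VolumeComparison` of route `GlueballBandRecursion`,
item ⟨stmt-QuantumFields-22957⟩ (`--supports`, helper; it closes nothing).  Piece C3 (support lifting across spatial volumes), assembly:
the KEPT part of the support-regrouped cluster expansion of `log Z` on a periodic box — singletons and closed connected supports with at
most `4k` plaquettes — is `∏_{spatial} nᵢ` times a ROOTED sum (w2's rooting of closed connected families + the free action, this seat's
factor-of-the-volume theorem), and the rooted sums of two boxes differing only in their spatial sides `≥ k + 1` agree (w3's inclusion);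
hence the per-site kept free energy of the tubes `a³ × T ⊆ a'³ × T` is the same, exactly, at every complex coupling.  Definition-free. -/
import Summits.QuantumFields.YangMills.Theorems.GlueballBandRecursionSupportLifting
import Summits.QuantumFields.YangMills.Theorems.GlueballBandRecursionSupportInclusion
import Summits.QuantumFields.YangMills.Theorems.GlueballBandRecursionClosedRootingUnique

/-!
# Route `GlueballBandRecursion`, LINE 7b: the kept support sum is the volume times a rooted sum; equality of the per-site kept sums
# across spatial volumes (piece C3, assembly)

Notation as in `…SupportExpansion` / `…SupportLifting` (always written out): `ψ_n(A)(z)` is the support sum of the label set `A` for the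
box plaquette system `boxSystem ρ n` at complex coupling `z`.  For a scale `k` the KEPT family of the box of sizes `n` is
«`#A = 1`, or `A` is CLOSED (`∀ p ∈ A, ∀ e ∈ p.bonds, ∃ q ∈ A, q ≠ p ∧ e ∈ q.bonds`), CONNECTED (`IsRConnected (boxSystem ρ n).Adj A`) and
`#A ≤ 4k`» — the family kept by the closedness-aware truncation (`Support.norm_pertLogZ_sub_sum_support_le_rate` with
`P A := closed ∧ connected ∧ #A ≤ 4k`; its complement among closed connected supports has `≥ 4k + 1` members,
`SlabCount.four_mul_add_one_le_card_of_not_rooted`, and non-closed supports vanish, `Support.support_sum_eq_zero_of_not_closed`).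

* §1 `exists_rooting_of_kept`, `rooting_free_of_kept`, `kept_image_rot_iff` — the hypotheses of
  `SupportLifting.sum_support_eq_size_mul_sum_rooted` for the kept family at scale `k` (`1 ≤ k < nᵢ`, all sides `≥ 4`): rooting by w2's
  `SlabCount.exists_rooting_of_closed` (singletons by hand), free action by w2's `SlabCount.rooting_rotation_unique`, translation invariance
  by `SlabCount.closed_image_rot_iff` / `isRConnected_rot_iff`.
* §2 **`kept_sum_eq_prod_mul_sum_rooted`** — `Σ_{kept} ψ_n = (∏_{i∈J} nᵢ) · Σ_{J-small, kept, rooted in J} ψ_n` (every `z`).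
* §3 **`rooted_kept_sum_eq_of_le`** — for sizes `n ≤ n'` agreeing outside `J` with `k + 1 ≤ nᵢ` on `J`, the rooted kept sums of the two
  boxes agree (w3's `BoxSupport.sum_support_sum_eq_of_le_of_iff`).
* §4 **`kept_sum_tube_mul_eq`** (H_lift of the LEAD's integration plan, 2026-08-28T20:47Z): for `4 ≤ a ≤ a'`, `4 ≤ T` and every complex `z`,
  `Σ_{kept_{a−1}} ψ_{![a',a',a',T]}(z) · a³ = Σ_{kept_{a−1}} ψ_{![a,a,a,T]}(z) · a'³` — the kept part of `log Z(b³×T)/b³` does not depend on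
  `b ≥ a` (with the kept family of scale `a − 1` in both boxes); `kept_sum_tube_eq_cube_mul`, `rooted_kept_sum_tube_eq`.

HONEST FRAMING.  Finite combinatorics; with the truncation (w4) and the tails this yields the LEAD's stub `ColdFreeEnergyVolumeJets` (LEAD's
file), a step toward the ∃-window strong-coupling RECORD rung `ColdDoublingRecursionSmallCoupling`; item 22957, the typed-window rung
`ColdDoublingRecursionStrongCoupling` and the Yang–Mills mass gap / the summit `YangMills` are NOT proved or advanced here.
-/

set_option autoImplicit false

noncomputable section

open MeasureTheory Finset
open Literature.Probability.LatticeModels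
open Literature.MathematicalPhysics.QuantumFieldTheory

namespace Summit.QuantumFields.YangMills.Theorems.GlueballBandRecursion.SupportLifting

variable {d : ℕ} {n n' : Fin d → ℕ} {G : Type*} [Group G] {N : ℕ} {ρ : G →* Matrix (Fin N) (Fin N) ℂ}

/-! ## §1 The kept family: rooting, free action, translation invariance -/

/-- **Every kept support can be rooted** at scale `k` in any direction `i` with `1 ≤ k < nᵢ` (all sides `≥ 4`): a singleton `{p}` by the
translation taking `coord i p` to `0`; a closed connected support with `≤ 4k` members by w2's `SlabCount.exists_rooting_of_closed`. -/
theorem exists_rooting_of_kept (hn : ∀ j, 4 ≤ n j) (i : Fin d) {k : ℕ} (hk0 : 0 < k) (hk : k < n i) {A : Finset (BoxLabel n)}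
    (hA : A.card = 1 ∨ ((∀ p ∈ A, ∀ e ∈ p.bonds, ∃ q ∈ A, q ≠ p ∧ e ∈ q.bonds) ∧
      IsRConnected (boxSystem (G := G) ρ n).Adj A ∧ A.card ≤ 4 * k)) :
    ∃ s, s < n i ∧ (∀ p ∈ A, BoxLabel.coord i (BoxLabel.rot i (n i - s) p) < k) ∧
      ∃ p ∈ A, BoxLabel.coord i (BoxLabel.rot i (n i - s) p) = 0 := by
  rcases hA with h1 | ⟨hclosed, hconn, hcard⟩
  · obtain ⟨p, rfl⟩ := Finset.card_eq_one.1 h1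
    have hc := BoxLabel.coord_lt i p
    have h0 : BoxLabel.coord i (BoxLabel.rot i (n i - BoxLabel.coord i p) p) = 0 := by
      rw [BoxLabel.coord_rot_self, Nat.add_sub_cancel' hc.le, Nat.mod_self]
    refine ⟨BoxLabel.coord i p, hc, fun q hq => ?_, p, Finset.mem_singleton_self p, h0⟩
    rw [Finset.mem_singleton.1 hq, h0]
    exact hk0
  · exact SlabCount.exists_rooting_of_closed (G := G) (ρ := ρ) hn hclosed hconn i hk hcard

/-- Every kept support is connected (a singleton is connected). -/
theorem isRConnected_of_kept {k : ℕ} {A : Finset (BoxLabel n)}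
    (hA : A.card = 1 ∨ ((∀ p ∈ A, ∀ e ∈ p.bonds, ∃ q ∈ A, q ≠ p ∧ e ∈ q.bonds) ∧
      IsRConnected (boxSystem (G := G) ρ n).Adj A ∧ A.card ≤ 4 * k)) :
    IsRConnected (boxSystem (G := G) ρ n).Adj A := by
  rcases hA with h1 | ⟨-, hconn, -⟩
  · obtain ⟨p, rfl⟩ := Finset.card_eq_one.1 h1
    refine ⟨Finset.singleton_nonempty p, fun v hv w hw => ?_⟩
    rw [Finset.mem_singleton] at hv hw
    subst hv; subst hw
    exact Relation.ReflTransGen.refl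
  · exact hconn

/-- **The translations act freely on rooted kept supports**: a kept support rooted at scale `k < nᵢ` in direction `i` (all sides `≥ 4`)
whose translate by `s < nᵢ` is again rooted has `s = 0` — w2's uniqueness of the rooting rotation of a connected family
(`SlabCount.rooting_rotation_unique`, no `2k ≤ nᵢ` needed) applied to the shifts `0` and `nᵢ − s`. -/
theorem rooting_free_of_kept (hn : ∀ j, 4 ≤ n j) (i : Fin d) {k : ℕ} (hk : k < n i) {A : Finset (BoxLabel n)}
    (hA : A.card = 1 ∨ ((∀ p ∈ A, ∀ e ∈ p.bonds, ∃ q ∈ A, q ≠ p ∧ e ∈ q.bonds) ∧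
      IsRConnected (boxSystem (G := G) ρ n).Adj A ∧ A.card ≤ 4 * k))
    (hlt : ∀ p ∈ A, BoxLabel.coord i p < k) (h0 : ∃ p ∈ A, BoxLabel.coord i p = 0) {s : ℕ} (hs : s < n i)
    (hlt' : ∀ p ∈ A, BoxLabel.coord i (BoxLabel.rot i s p) < k) (h0' : ∃ p ∈ A, BoxLabel.coord i (BoxLabel.rot i s p) = 0) :
    s = 0 := by
  have hconn := isRConnected_of_kept (G := G) (ρ := ρ) (k := k) hA
  have hn3 : ∀ j, 3 ≤ n j := fun j => le_trans (by norm_num) (hn j)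
  by_contra hs0
  have hs' : n i - s < n i := Nat.sub_lt (lt_of_le_of_lt (Nat.zero_le _) hs) (Nat.pos_of_ne_zero hs0)
  have hsub : n i - (n i - s) = s := Nat.sub_sub_self hs.le
  have huniq := SlabCount.rooting_rotation_unique (G := G) (ρ := ρ) hn3 hconn i hk (s := 0) (s' := n i - s)
    (lt_of_le_of_lt (Nat.zero_le _) hs) hs'
    (fun p hp => by rw [Nat.sub_zero, BoxLabel.rot_size]; exact hlt p hp)
    (by obtain ⟨p, hp, hp0⟩ := h0; exact ⟨p, hp, by rw [Nat.sub_zero, BoxLabel.rot_size]; exact hp0⟩)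
    (fun p hp => by rw [hsub]; exact hlt' p hp)
    (by obtain ⟨p, hp, hp0⟩ := h0'; exact ⟨p, hp, by rw [hsub]; exact hp0⟩)
  omega

variable [TopologicalSpace G] [IsTopologicalGroup G] [CompactSpace G] [MeasurableSpace G] [BorelSpace G]

omit [TopologicalSpace G] [IsTopologicalGroup G] [CompactSpace G] [MeasurableSpace G] [BorelSpace G] in
/-- **The kept family is translation invariant** (cardinality, closedness — `SlabCount.closed_image_rot_iff` — and connectedness —
`isRConnected_rot_iff` — are). -/
theorem kept_image_rot_iff (i : Fin d) (s k : ℕ) (A : Finset (BoxLabel n)) :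
    ((A.image (BoxLabel.rot i s)).card = 1 ∨
        ((∀ p ∈ A.image (BoxLabel.rot i s), ∀ e ∈ p.bonds, ∃ q ∈ A.image (BoxLabel.rot i s), q ≠ p ∧ e ∈ q.bonds) ∧
          IsRConnected (boxSystem (G := G) ρ n).Adj (A.image (BoxLabel.rot i s)) ∧ (A.image (BoxLabel.rot i s)).card ≤ 4 * k)) ↔
      (A.card = 1 ∨ ((∀ p ∈ A, ∀ e ∈ p.bonds, ∃ q ∈ A, q ≠ p ∧ e ∈ q.bonds) ∧
        IsRConnected (boxSystem (G := G) ρ n).Adj A ∧ A.card ≤ 4 * k)) := by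
  rw [Finset.card_image_of_injective _ (BoxLabel.rot_injective i s), SlabCount.closed_image_rot_iff,
    isRConnected_rot_iff (G := G) (ρ := ρ)]

/-! ## §2 The kept support sum is the volume times a rooted sum -/

open scoped Classical in
/-- **The kept part of the support-regrouped cluster expansion is `∏_{i∈J} nᵢ` times a rooted sum.**  All sides `≥ 4`, `1 ≤ k < nᵢ` for
`i ∈ J`; for every complex coupling `z`:
`Σ_{A kept} ψ_n(A)(z) = (∏_{i∈J} nᵢ) · Σ_{A J-small, kept, rooted in every j ∈ J} ψ_n(A)(z)`,
where «`J`-small» means all `J`-coordinates `< k` and «rooted in `j`» that some member has `j`-coordinate `0`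
(`SupportLifting.sum_support_eq_prod_mul_sum_of_iff` with §1). -/
theorem kept_sum_eq_prod_mul_sum_rooted (hρ : Continuous ρ) (hn : ∀ j, 4 ≤ n j) (J : Finset (Fin d)) {k : ℕ} (hk0 : 0 < k)
    (hk : ∀ i ∈ J, k < n i) (z : ℂ) :
    ∑ A ∈ (Finset.univ : Finset (BoxLabel n)).powerset with
        (A.card = 1 ∨ ((∀ p ∈ A, ∀ e ∈ p.bonds, ∃ q ∈ A, q ≠ p ∧ e ∈ q.bonds) ∧
          IsRConnected (boxSystem (G := G) ρ n).Adj A ∧ A.card ≤ 4 * k)),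
        ∑ 𝒞 ∈ (rconnSubsets (boxSystem (G := G) ρ n).Adj A).powerset with 𝒞.biUnion id = A,
          truncatedWeight (GeomInc (boxSystem (G := G) ρ n).Adj)
            (connActivity (boxSystem (G := G) ρ n).Adj (zdHaar d G) ((boxSystem (G := G) ρ n).weight z)) 𝒞 =
      (∏ i ∈ J, (n i : ℂ)) * ∑ A ∈ (Finset.univ : Finset (BoxLabel n)).powerset with
          ((∀ p ∈ A, ∀ j ∈ J, BoxLabel.coord j p < k) ∧
            ((A.card = 1 ∨ ((∀ p ∈ A, ∀ e ∈ p.bonds, ∃ q ∈ A, q ≠ p ∧ e ∈ q.bonds) ∧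
              IsRConnected (boxSystem (G := G) ρ n).Adj A ∧ A.card ≤ 4 * k)) ∧
              ∀ j ∈ J, ∃ p ∈ A, BoxLabel.coord j p = 0)),
        ∑ 𝒞 ∈ (rconnSubsets (boxSystem (G := G) ρ n).Adj A).powerset with 𝒞.biUnion id = A,
          truncatedWeight (GeomInc (boxSystem (G := G) ρ n).Adj)
            (connActivity (boxSystem (G := G) ρ n).Adj (zdHaar d G) ((boxSystem (G := G) ρ n).weight z)) 𝒞 := by
  refine sum_support_eq_prod_mul_sum_of_iff (G := G) (ρ := ρ) hρ J k _ (fun i _ s A => kept_image_rot_iff (G := G) (ρ := ρ) i s k A)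
    (fun i hi A hA => exists_rooting_of_kept (G := G) (ρ := ρ) hn i hk0 (hk i hi) hA)
    (fun i hi A hA hlt h0 s hs hlt' h0' => rooting_free_of_kept (G := G) (ρ := ρ) hn i (hk i hi) hA hlt h0 hs hlt' h0') _
    (fun A => ?_) z
  constructor
  · rintro ⟨hsmall, hkept, hroot⟩
    exact ⟨hkept, fun j hj => ⟨fun p hp => hsmall p hp j hj, hroot j hj⟩⟩
  · rintro ⟨hkept, hroot⟩
    exact ⟨fun p hp j hj => (hroot j hj).1 p hp, hkept, fun j hj => (hroot j hj).2⟩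

/-! ## §3 The rooted kept sums of nested boxes agree -/

open scoped Classical in
/-- **The rooted kept sum does not see the sizes in the directions of `J`.**  Sizes `n ≤ n'` agreeing outside `J`, `k + 1 ≤ nᵢ` for
`i ∈ J`, all `nᵢ > 0`; for every complex `z` the `J`-small rooted kept sums of the boxes of sizes `n'` and `n` coincide (w3's
`BoxSupport.sum_support_sum_eq_of_le_of_iff`: along the inclusion `BoxLabel.castLE` the `J`-small label sets keep cardinality, closedness,
connectedness, coordinates and support sums). -/
theorem rooted_kept_sum_eq_of_le (hρ : Continuous ρ) (h : ∀ i, n i ≤ n' i) (J : Finset (Fin d))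
    (hJ : ∀ i, i ∉ J → n i = n' i) {k : ℕ} (hk : ∀ i ∈ J, k + 1 ≤ n i) (hpos : ∀ i, 0 < n i) (z : ℂ) :
    ∑ A' ∈ (Finset.univ : Finset (BoxLabel n')).powerset with
        ((∀ p' ∈ A', ∀ j ∈ J, BoxLabel.coord j p' < k) ∧
          ((A'.card = 1 ∨ ((∀ p' ∈ A', ∀ e ∈ p'.bonds, ∃ q' ∈ A', q' ≠ p' ∧ e ∈ q'.bonds) ∧
            IsRConnected (boxSystem (G := G) ρ n').Adj A' ∧ A'.card ≤ 4 * k)) ∧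
            ∀ j ∈ J, ∃ p' ∈ A', BoxLabel.coord j p' = 0)),
        ∑ 𝒞 ∈ (rconnSubsets (boxSystem (G := G) ρ n').Adj A').powerset with 𝒞.biUnion id = A',
          truncatedWeight (GeomInc (boxSystem (G := G) ρ n').Adj)
            (connActivity (boxSystem (G := G) ρ n').Adj (zdHaar d G) ((boxSystem (G := G) ρ n').weight z)) 𝒞 =
      ∑ A ∈ (Finset.univ : Finset (BoxLabel n)).powerset with
        ((∀ p ∈ A, ∀ j ∈ J, BoxLabel.coord j p < k) ∧
          ((A.card = 1 ∨ ((∀ p ∈ A, ∀ e ∈ p.bonds, ∃ q ∈ A, q ≠ p ∧ e ∈ q.bonds) ∧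
            IsRConnected (boxSystem (G := G) ρ n).Adj A ∧ A.card ≤ 4 * k)) ∧
            ∀ j ∈ J, ∃ p ∈ A, BoxLabel.coord j p = 0)),
        ∑ 𝒞 ∈ (rconnSubsets (boxSystem (G := G) ρ n).Adj A).powerset with 𝒞.biUnion id = A,
          truncatedWeight (GeomInc (boxSystem (G := G) ρ n).Adj)
            (connActivity (boxSystem (G := G) ρ n).Adj (zdHaar d G) ((boxSystem (G := G) ρ n).weight z)) 𝒞 := by
  refine BoxSupport.sum_support_sum_eq_of_le_of_iff (G := G) ρ hρ h J hJ hk hpos _ _ (fun A hA => ?_) z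
  rw [BoxSupport.card_image_castLE, BoxSupport.closed_image_castLE_iff h hJ hk hA,
    BoxSupport.isRConnected_image_castLE_iff (G := G) ρ h hJ hk hA]
  simp only [Finset.mem_image, exists_exists_and_eq_and, BoxSupport.coord_castLE]

/-! ## §4 The tubes `a³ × T ⊆ a'³ × T`: equality of the per-site kept sums -/

/-- Sizes of the tubes: all sides `≥ 4`. -/
theorem tube_four_le {a T : ℕ} (ha : 4 ≤ a) (hT : 4 ≤ T) : ∀ j : Fin 4, 4 ≤ (![a, a, a, T] : Fin 4 → ℕ) j := by
  intro j
  fin_cases j <;> assumption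

/-- Sizes of nested tubes with the same period. -/
theorem tube_spatial_le {a a' T : ℕ} (h : a ≤ a') : ∀ i : Fin 4, (![a, a, a, T] : Fin 4 → ℕ) i ≤ ![a', a', a', T] i := by
  intro i
  fin_cases i
  · exact h
  · exact h
  · exact h
  · exact le_rfl

/-- The tubes `a³ × T`, `a'³ × T` agree in the time direction. -/
theorem tube_spatial_eq_of_ne {a a' T : ℕ} : ∀ i : Fin 4, i ∉ ({0, 1, 2} : Finset (Fin 4)) →
    (![a, a, a, T] : Fin 4 → ℕ) i = ![a', a', a', T] i := by
  intro i hi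
  fin_cases i <;> simp at hi ⊢

/-- The spatial sides of the tube `a³ × T` are `a`. -/
theorem tube_spatial_apply {a T : ℕ} : ∀ i ∈ ({0, 1, 2} : Finset (Fin 4)), (![a, a, a, T] : Fin 4 → ℕ) i = a := by
  intro i hi
  simp only [Finset.mem_insert, Finset.mem_singleton] at hi
  rcases hi with rfl | rfl | rfl <;> rfl

/-- The product of the spatial sides of the tube `a³ × T` is `a³`. -/
theorem prod_tube_spatial {a T : ℕ} : ∏ i ∈ ({0, 1, 2} : Finset (Fin 4)), (((![a, a, a, T] : Fin 4 → ℕ) i : ℕ) : ℂ) = (a : ℂ) ^ 3 := by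
  rw [Finset.prod_congr rfl fun i hi => by rw [tube_spatial_apply i hi]]
  simp

open scoped Classical in
/-- **The kept support sum of the tube `b³ × T` is `b³` times the rooted kept sum** (scale `k`, `1 ≤ k < b`, `4 ≤ b`, `4 ≤ T`). -/
theorem kept_sum_tube_eq_cube_mul (hρ : Continuous ρ) {b T k : ℕ} (hb : 4 ≤ b) (hT : 4 ≤ T) (hk0 : 0 < k) (hkb : k < b) (z : ℂ) :
    ∑ A ∈ (Finset.univ : Finset (BoxLabel (![b, b, b, T] : Fin 4 → ℕ))).powerset with
        (A.card = 1 ∨ ((∀ p ∈ A, ∀ e ∈ p.bonds, ∃ q ∈ A, q ≠ p ∧ e ∈ q.bonds) ∧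
          IsRConnected (boxSystem (G := G) ρ (![b, b, b, T] : Fin 4 → ℕ)).Adj A ∧ A.card ≤ 4 * k)),
        ∑ 𝒞 ∈ (rconnSubsets (boxSystem (G := G) ρ (![b, b, b, T] : Fin 4 → ℕ)).Adj A).powerset with 𝒞.biUnion id = A,
          truncatedWeight (GeomInc (boxSystem (G := G) ρ (![b, b, b, T] : Fin 4 → ℕ)).Adj)
            (connActivity (boxSystem (G := G) ρ (![b, b, b, T] : Fin 4 → ℕ)).Adj (zdHaar 4 G)
              ((boxSystem (G := G) ρ (![b, b, b, T] : Fin 4 → ℕ)).weight z)) 𝒞 =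
      (b : ℂ) ^ 3 * ∑ A ∈ (Finset.univ : Finset (BoxLabel (![b, b, b, T] : Fin 4 → ℕ))).powerset with
          ((∀ p ∈ A, ∀ j ∈ ({0, 1, 2} : Finset (Fin 4)), BoxLabel.coord j p < k) ∧
            ((A.card = 1 ∨ ((∀ p ∈ A, ∀ e ∈ p.bonds, ∃ q ∈ A, q ≠ p ∧ e ∈ q.bonds) ∧
              IsRConnected (boxSystem (G := G) ρ (![b, b, b, T] : Fin 4 → ℕ)).Adj A ∧ A.card ≤ 4 * k)) ∧
              ∀ j ∈ ({0, 1, 2} : Finset (Fin 4)), ∃ p ∈ A, BoxLabel.coord j p = 0)),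
        ∑ 𝒞 ∈ (rconnSubsets (boxSystem (G := G) ρ (![b, b, b, T] : Fin 4 → ℕ)).Adj A).powerset with 𝒞.biUnion id = A,
          truncatedWeight (GeomInc (boxSystem (G := G) ρ (![b, b, b, T] : Fin 4 → ℕ)).Adj)
            (connActivity (boxSystem (G := G) ρ (![b, b, b, T] : Fin 4 → ℕ)).Adj (zdHaar 4 G)
              ((boxSystem (G := G) ρ (![b, b, b, T] : Fin 4 → ℕ)).weight z)) 𝒞 := by
  have h := kept_sum_eq_prod_mul_sum_rooted (G := G) (ρ := ρ) (n := (![b, b, b, T] : Fin 4 → ℕ)) hρ (tube_four_le hb hT)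
    ({0, 1, 2} : Finset (Fin 4)) hk0 (fun i hi => by rw [tube_spatial_apply i hi]; exact hkb) z
  rw [prod_tube_spatial] at h
  refine (sum_filter_congr_prop (fun _ _ => Iff.rfl) _).trans (h.trans ?_)
  congr 1
  exact sum_filter_congr_prop (fun _ _ => Iff.rfl) _

open scoped Classical in
/-- **The rooted kept sums of the tubes `a³ × T ⊆ a'³ × T` agree** (scale `k` with `k + 1 ≤ a ≤ a'`, `0 < a`, `0 < T`). -/
theorem rooted_kept_sum_tube_eq (hρ : Continuous ρ) {a a' T k : ℕ} (haa' : a ≤ a') (hka : k + 1 ≤ a) (ha : 0 < a) (hT : 0 < T)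
    (z : ℂ) :
    ∑ A' ∈ (Finset.univ : Finset (BoxLabel (![a', a', a', T] : Fin 4 → ℕ))).powerset with
        ((∀ p' ∈ A', ∀ j ∈ ({0, 1, 2} : Finset (Fin 4)), BoxLabel.coord j p' < k) ∧
          ((A'.card = 1 ∨ ((∀ p' ∈ A', ∀ e ∈ p'.bonds, ∃ q' ∈ A', q' ≠ p' ∧ e ∈ q'.bonds) ∧
            IsRConnected (boxSystem (G := G) ρ (![a', a', a', T] : Fin 4 → ℕ)).Adj A' ∧ A'.card ≤ 4 * k)) ∧
            ∀ j ∈ ({0, 1, 2} : Finset (Fin 4)), ∃ p' ∈ A', BoxLabel.coord j p' = 0)),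
        ∑ 𝒞 ∈ (rconnSubsets (boxSystem (G := G) ρ (![a', a', a', T] : Fin 4 → ℕ)).Adj A').powerset with 𝒞.biUnion id = A',
          truncatedWeight (GeomInc (boxSystem (G := G) ρ (![a', a', a', T] : Fin 4 → ℕ)).Adj)
            (connActivity (boxSystem (G := G) ρ (![a', a', a', T] : Fin 4 → ℕ)).Adj (zdHaar 4 G)
              ((boxSystem (G := G) ρ (![a', a', a', T] : Fin 4 → ℕ)).weight z)) 𝒞 =
      ∑ A ∈ (Finset.univ : Finset (BoxLabel (![a, a, a, T] : Fin 4 → ℕ))).powerset with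
        ((∀ p ∈ A, ∀ j ∈ ({0, 1, 2} : Finset (Fin 4)), BoxLabel.coord j p < k) ∧
          ((A.card = 1 ∨ ((∀ p ∈ A, ∀ e ∈ p.bonds, ∃ q ∈ A, q ≠ p ∧ e ∈ q.bonds) ∧
            IsRConnected (boxSystem (G := G) ρ (![a, a, a, T] : Fin 4 → ℕ)).Adj A ∧ A.card ≤ 4 * k)) ∧
            ∀ j ∈ ({0, 1, 2} : Finset (Fin 4)), ∃ p ∈ A, BoxLabel.coord j p = 0)),
        ∑ 𝒞 ∈ (rconnSubsets (boxSystem (G := G) ρ (![a, a, a, T] : Fin 4 → ℕ)).Adj A).powerset with 𝒞.biUnion id = A,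
          truncatedWeight (GeomInc (boxSystem (G := G) ρ (![a, a, a, T] : Fin 4 → ℕ)).Adj)
            (connActivity (boxSystem (G := G) ρ (![a, a, a, T] : Fin 4 → ℕ)).Adj (zdHaar 4 G)
              ((boxSystem (G := G) ρ (![a, a, a, T] : Fin 4 → ℕ)).weight z)) 𝒞 := by
  have h := rooted_kept_sum_eq_of_le (G := G) (ρ := ρ) (n := (![a, a, a, T] : Fin 4 → ℕ))
    (n' := (![a', a', a', T] : Fin 4 → ℕ)) hρ (tube_spatial_le haa') ({0, 1, 2} : Finset (Fin 4)) tube_spatial_eq_of_ne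
    (k := k) (fun i hi => by rw [tube_spatial_apply i hi]; exact hka) (tube_sizes_pos ha hT) z
  exact (sum_filter_congr_prop (fun _ _ => Iff.rfl) _).trans (h.trans (sum_filter_congr_prop (fun _ _ => Iff.rfl) _))

open scoped Classical in
/-- **H_lift — the per-site kept sums of the tubes `a³ × T` and `a'³ × T` agree.**  For `4 ≤ a ≤ a'`, `4 ≤ T` and every complex
coupling `z`, with the kept family of scale `a − 1` in BOTH boxes («`#A = 1`, or closed, connected, `#A ≤ 4(a−1)`»):
`(Σ_{kept} ψ_{![a',a',a',T]})(z) · a³ = (Σ_{kept} ψ_{![a,a,a,T]})(z) · a'³`.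
Both are `b³ ×` the same rooted sum (`kept_sum_tube_eq_cube_mul`, `rooted_kept_sum_tube_eq`): small closed connected supports neither wind
nor span a spatial torus of side `≥ a`, so they root, translate and lift identically in the two volumes. -/
theorem kept_sum_tube_mul_eq (hρ : Continuous ρ) {a a' T : ℕ} (ha : 4 ≤ a) (haa' : a ≤ a') (hT : 4 ≤ T) (z : ℂ) :
    (∑ A' ∈ (Finset.univ : Finset (BoxLabel (![a', a', a', T] : Fin 4 → ℕ))).powerset with
        (A'.card = 1 ∨ ((∀ p' ∈ A', ∀ e ∈ p'.bonds, ∃ q' ∈ A', q' ≠ p' ∧ e ∈ q'.bonds) ∧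
          IsRConnected (boxSystem (G := G) ρ (![a', a', a', T] : Fin 4 → ℕ)).Adj A' ∧ A'.card ≤ 4 * (a - 1))),
        ∑ 𝒞 ∈ (rconnSubsets (boxSystem (G := G) ρ (![a', a', a', T] : Fin 4 → ℕ)).Adj A').powerset with 𝒞.biUnion id = A',
          truncatedWeight (GeomInc (boxSystem (G := G) ρ (![a', a', a', T] : Fin 4 → ℕ)).Adj)
            (connActivity (boxSystem (G := G) ρ (![a', a', a', T] : Fin 4 → ℕ)).Adj (zdHaar 4 G)
              ((boxSystem (G := G) ρ (![a', a', a', T] : Fin 4 → ℕ)).weight z)) 𝒞) * (a : ℂ) ^ 3 =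
      (∑ A ∈ (Finset.univ : Finset (BoxLabel (![a, a, a, T] : Fin 4 → ℕ))).powerset with
        (A.card = 1 ∨ ((∀ p ∈ A, ∀ e ∈ p.bonds, ∃ q ∈ A, q ≠ p ∧ e ∈ q.bonds) ∧
          IsRConnected (boxSystem (G := G) ρ (![a, a, a, T] : Fin 4 → ℕ)).Adj A ∧ A.card ≤ 4 * (a - 1))),
        ∑ 𝒞 ∈ (rconnSubsets (boxSystem (G := G) ρ (![a, a, a, T] : Fin 4 → ℕ)).Adj A).powerset with 𝒞.biUnion id = A,
          truncatedWeight (GeomInc (boxSystem (G := G) ρ (![a, a, a, T] : Fin 4 → ℕ)).Adj)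
            (connActivity (boxSystem (G := G) ρ (![a, a, a, T] : Fin 4 → ℕ)).Adj (zdHaar 4 G)
              ((boxSystem (G := G) ρ (![a, a, a, T] : Fin 4 → ℕ)).weight z)) 𝒞) * (a' : ℂ) ^ 3 := by
  have hk0 : 0 < a - 1 := by omega
  have hka : a - 1 < a := by omega
  have hka' : a - 1 < a' := by omega
  rw [kept_sum_tube_eq_cube_mul (G := G) (ρ := ρ) hρ (le_trans ha haa') hT hk0 hka' z,
    kept_sum_tube_eq_cube_mul (G := G) (ρ := ρ) hρ ha hT hk0 hka z,
    rooted_kept_sum_tube_eq (G := G) (ρ := ρ) hρ haa' (by omega) (by omega) (by omega) z]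
  ring

end Summit.QuantumFields.YangMills.Theorems.GlueballBandRecursion.SupportLifting

end
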